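import Literature.Topology.FourManifolds.GroupTrisections
import HarnessLib

/-!
# Endomorphisms and automorphisms of the surface group `S_g` from generator images

Topic `Literature/Topology/FourManifolds`; companion to `GroupTrisections.lean` (the presented
surface group `SurfaceGroup g = ⟨a₀, b₀, …, a_{g-1}, b_{g-1} ∣ ∏ᵢ [aᵢ, bᵢ]⟩` of Abrams–Gay–Kirby's
group trisections).  Toolkit for writing down automorphisms of the one-relator group `S_g` by
generator images fixing the surface relator ON THE NOSE (Zieschang–Vogt–Coldewey, Ch. 5: every
automorphism of `S_g` comes from a free automorphism sending the relator to a conjugate of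
itself or its inverse; here only the easy direction — such images DEFINE endomorphisms — is
needed and proved), used by `SurfaceGroupHandleMoves.lean` (inversions, handle slides, cut
swaps) and `HandlebodyGroupRealisation.lean` (Griffiths 1964: automorphisms of `π₁` of a
handlebody lift to `Aut S_g`):

* `SurfaceGroup.relFactor f i = f(aᵢ) f(bᵢ) f(aᵢ)⁻¹ f(bᵢ)⁻¹` and `lift_surfaceRelator` — the image
  of the relator under `FreeGroup.lift f` is the ORDERED list product `∏_{i<g} relFactor f i`;
  `prod_relFactor_of` (the relation of `S_g` as a list identity),
  `lift_surfaceRelator_eq_one_of_hits` (a cut through every handle kills the relator);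
* `prod_map_range_eq_of_block` — two lists of factors agreeing off `{k, l}` whose blocks
  `F k · (∏_{k<i<l} F i) · F l` agree have equal products (splitting `List.range` at `k < l`);
* `SurfaceGroup.homOfGens`, `equivOfGens` — the endomorphism / automorphism of `S_g` with given
  generator images (and inverse images) killing the relator;
* `localGens A B` (`aᵢ ↦ A i`, `bᵢ ↦ B i`; kills the relator when every `[A i, B i] = [aᵢ, bᵢ]`,
  `prod_relFactor_localGens`) and `blockGens k l Ak Bk Al Bl` (two handles `k < l` changed, the
  others fixed; kills the relator when the block `[Ak,Bk] · mid k l · [Al,Bl]` equals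
  `[a_k,b_k] · mid k l · [a_l,b_l]`, `prod_relFactor_blockGens`), where
  `mid k l = ∏_{k<h<l} [a_h, b_h]` is the middle block (`map_mid`: fixed by every endomorphism
  fixing the intermediate generators; `map_mid_eq_one`: killed with any cut).

## References

* H. Zieschang, E. Vogt, H.-D. Coldewey, *Surfaces and Planar Discontinuous Groups*, LNM 835
  (1980), Ch. 5 (binary products; Thm. 5.6.1). [ZieschangVogtColdewey1980]
* A. Abrams, D. Gay, R. Kirby, *Group trisections and smooth 4-manifolds*, Geom. Topol. 22
  (2018), §1 (the surface group `S_g`). [AbramsGayKirby2018]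
-/

noncomputable section

namespace Literature.Topology.FourManifolds

open Subgroup

namespace SurfaceGroup

variable {g : ℕ}

/-! ## The surface relator as a list product -/

/-- The `i`-th factor `f(aᵢ) f(bᵢ) f(aᵢ)⁻¹ f(bᵢ)⁻¹` of the image of the surface relator under an
assignment `f` of the generators (`1` for `i ≥ g`). [folklore] -/
def relFactor {M : Type*} [Group M] (f : surfaceGen g → M) (i : ℕ) : M :=
  if h : i < g then
    f (⟨i, h⟩, false) * f (⟨i, h⟩, true) * (f (⟨i, h⟩, false))⁻¹ * (f (⟨i, h⟩, true))⁻¹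
  else 1

/-- `relFactor` at an index `i < g`. [folklore] -/
theorem relFactor_fin {M : Type*} [Group M] (f : surfaceGen g → M) (i : Fin g) :
    relFactor f i = f (i, false) * f (i, true) * (f (i, false))⁻¹ * (f (i, true))⁻¹ := by
  simp [relFactor, i.2]

/-- Homomorphisms commute with `relFactor`. [folklore] -/
theorem map_relFactor {M N : Type*} [Group M] [Group N] (φ : M →* N) (f : surfaceGen g → M)
    (i : ℕ) : φ (relFactor f i) = relFactor (⇑φ ∘ f) i := by
  unfold relFactor
  split_ifs <;> simp [map_mul, map_inv]

/-- A factor one of whose two generators is sent to `1` is trivial. [folklore] -/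
theorem relFactor_eq_one_of_hits {M : Type*} [Group M] (f : surfaceGen g → M) (i : ℕ)
    (hf : ∀ j : Fin g, f (j, false) = 1 ∨ f (j, true) = 1) : relFactor f i = 1 := by
  unfold relFactor
  split_ifs with h
  · rcases hf ⟨i, h⟩ with h1 | h1 <;> simp [h1]
  · rfl

/-- The image of the surface relator under `FreeGroup.lift f` is the ordered product of the
factors `relFactor f i`, `i < g`. [folklore] -/
theorem lift_surfaceRelator {M : Type*} [Group M] (f : surfaceGen g → M) :
    FreeGroup.lift f (surfaceRelator g) = ((List.range g).map (relFactor f)).prod := by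
  unfold surfaceRelator
  rw [map_list_prod, List.map_map, ← List.map_coe_finRange_eq_range, List.map_map]
  congr 1
  refine List.map_congr_left fun i _ => ?_
  simp [relFactor_fin, genA, genB]

/-- If a cut through every handle is sent to `1`, the relator dies. [folklore] -/
theorem lift_surfaceRelator_eq_one_of_hits {M : Type*} [Group M] (f : surfaceGen g → M)
    (hf : ∀ j : Fin g, f (j, false) = 1 ∨ f (j, true) = 1) :
    FreeGroup.lift f (surfaceRelator g) = 1 := by
  rw [lift_surfaceRelator]
  exact List.prod_eq_one fun x hx => by
    obtain ⟨i, -, rfl⟩ := List.mem_map.1 hx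
    exact relFactor_eq_one_of_hits f i hf

/-- The defining relation of `S_g` as a list identity: `∏ᵢ [aᵢ, bᵢ] = 1`. [folklore] -/
theorem prod_relFactor_of :
    ((List.range g).map (relFactor fun p => (PresentedGroup.of p : SurfaceGroup g))).prod = 1 := by
  rw [← lift_surfaceRelator]
  have h : FreeGroup.lift (fun p => (PresentedGroup.of p : SurfaceGroup g)) =
      PresentedGroup.mk ({surfaceRelator g} : Set (FreeGroup (surfaceGen g))) :=
    FreeGroup.ext_hom _ _ fun p => by simp [PresentedGroup.of]
  rw [h]
  exact PresentedGroup.one_of_mem (Set.mem_singleton _)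

/-! ## Splitting a list product around two positions -/

/-- Two lists of factors indexed by `range n` which agree off `{k, l}` (`k < l < n`) and whose
blocks `F k · (∏_{k<i<l} F i) · F l` agree have the same product. [folklore] -/
theorem prod_map_range_eq_of_block {M : Type*} [Monoid M] {F F' : ℕ → M} {n k l : ℕ}
    (hkl : k < l) (hln : l < n) (heq : ∀ i, i ≠ k → i ≠ l → F' i = F i)
    (hblock : F' k * (((List.range' (k + 1) (l - k - 1)).map F).prod * F' l) =
      F k * (((List.range' (k + 1) (l - k - 1)).map F).prod * F l)) :
    ((List.range n).map F').prod = ((List.range n).map F).prod := by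
  obtain ⟨d, rfl⟩ : ∃ d, l = k + 1 + d := ⟨l - (k + 1), by omega⟩
  obtain ⟨e, rfl⟩ : ∃ e, n = k + 1 + d + 1 + e := ⟨n - (k + 1 + d + 1), by omega⟩
  rw [show k + 1 + d - k - 1 = d by omega] at hblock
  have hsplit : List.range (k + 1 + d + 1 + e) = List.range' 0 k ++
      k :: (List.range' (k + 1) d ++ (k + 1 + d) :: List.range' (k + 1 + d + 1) e) := by
    rw [List.range_eq_range', show k + 1 + d + 1 + e = k + (1 + (d + (1 + e))) by omega,
      ← List.range'_append_1, ← List.range'_append_1, ← List.range'_append_1,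
      ← List.range'_append_1]
    simp
  have hcongr : ∀ s t : ℕ, (∀ i ∈ List.range' s t, i ≠ k ∧ i ≠ k + 1 + d) →
      (List.range' s t).map F' = (List.range' s t).map F := fun s t hst =>
    List.map_congr_left fun i hi => heq i (hst i hi).1 (hst i hi).2
  rw [hsplit]
  simp only [List.map_append, List.map_cons, List.prod_append, List.prod_cons]
  rw [hcongr 0 k fun i hi => ⟨by simp at hi; omega, by simp at hi; omega⟩,
    hcongr (k + 1) d fun i hi => ⟨by simp at hi; omega, by simp at hi; omega⟩,
    hcongr (k + 1 + d + 1) e fun i hi => ⟨by simp at hi; omega, by simp at hi; omega⟩]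
  congr 1
  simp only [← mul_assoc] at hblock ⊢
  rw [hblock]

/-! ## Endomorphisms and automorphisms of `S_g` from generator images -/

/-- The homomorphism `S_g →* M` with prescribed generator images killing the relator.
[folklore] -/
def homOfGens {M : Type*} [Group M] (f : surfaceGen g → M)
    (h : ((List.range g).map (relFactor f)).prod = 1) : SurfaceGroup g →* M :=
  PresentedGroup.toGroup (f := f) (by
    intro r hr
    rw [Set.mem_singleton_iff] at hr
    subst hr
    rwa [lift_surfaceRelator])

/-- `homOfGens f` on a generator. [folklore] -/
@[simp] theorem homOfGens_of {M : Type*} [Group M] (f : surfaceGen g → M) (h) (p : surfaceGen g) :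
    homOfGens f h (PresentedGroup.of p) = f p :=
  PresentedGroup.toGroup.of _

/-- `homOfGens f` on `aᵢ`. [folklore] -/
@[simp] theorem homOfGens_a {M : Type*} [Group M] (f : surfaceGen g → M) (h) (i : Fin g) :
    homOfGens f h (a i) = f (i, false) :=
  PresentedGroup.toGroup.of _

/-- `homOfGens f` on `bᵢ`. [folklore] -/
@[simp] theorem homOfGens_b {M : Type*} [Group M] (f : surfaceGen g → M) (h) (i : Fin g) :
    homOfGens f h (b i) = f (i, true) :=
  PresentedGroup.toGroup.of _

/-- `aᵢ` is the generator `(i, false)`. [folklore] -/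
theorem a_def (i : Fin g) : (a i : SurfaceGroup g) = PresentedGroup.of (i, false) := rfl

/-- `bᵢ` is the generator `(i, true)`. [folklore] -/
theorem b_def (i : Fin g) : (b i : SurfaceGroup g) = PresentedGroup.of (i, true) := rfl

/-- An automorphism of `S_g` from generator images `f` and inverse generator images `f'`, both
killing the relator, mutually inverse on generators. [folklore] -/
def equivOfGens (f f' : surfaceGen g → SurfaceGroup g)
    (hf : ((List.range g).map (relFactor f)).prod = 1)
    (hf' : ((List.range g).map (relFactor f')).prod = 1)
    (h₁ : ∀ p, homOfGens f' hf' (f p) = PresentedGroup.of p)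
    (h₂ : ∀ p, homOfGens f hf (f' p) = PresentedGroup.of p) : SurfaceGroup g ≃* SurfaceGroup g :=
  MonoidHom.toMulEquiv (homOfGens f hf) (homOfGens f' hf')
    (PresentedGroup.ext fun p => by simpa using h₁ p)
    (PresentedGroup.ext fun p => by simpa using h₂ p)

/-- `equivOfGens` on a generator. [folklore] -/
@[simp] theorem equivOfGens_of (f f' : surfaceGen g → SurfaceGroup g) (hf hf' h₁ h₂)
    (p : surfaceGen g) : equivOfGens f f' hf hf' h₁ h₂ (PresentedGroup.of p) = f p :=
  homOfGens_of f hf p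

/-- The inverse of `equivOfGens` on a generator. [folklore] -/
@[simp] theorem equivOfGens_symm_of (f f' : surfaceGen g → SurfaceGroup g) (hf hf' h₁ h₂)
    (p : surfaceGen g) : (equivOfGens f f' hf hf' h₁ h₂).symm (PresentedGroup.of p) = f' p :=
  homOfGens_of f' hf' p

/-! ### Handle-local generator images -/

/-- Generator images of a handle-local map: `aᵢ ↦ A i`, `bᵢ ↦ B i`. [folklore] -/
def localGens (A B : Fin g → SurfaceGroup g) (p : surfaceGen g) : SurfaceGroup g :=
  bif p.2 then B p.1 else A p.1

/-- `localGens` on `aᵢ`. [folklore] -/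
@[simp] theorem localGens_false (A B : Fin g → SurfaceGroup g) (i : Fin g) :
    localGens A B (i, false) = A i := rfl

/-- `localGens` on `bᵢ`. [folklore] -/
@[simp] theorem localGens_true (A B : Fin g → SurfaceGroup g) (i : Fin g) :
    localGens A B (i, true) = B i := rfl

/-- Handle-local images preserving each `[aᵢ, bᵢ]` kill the relator. [folklore] -/
theorem prod_relFactor_localGens (A B : Fin g → SurfaceGroup g)
    (hAB : ∀ i, A i * B i * (A i)⁻¹ * (B i)⁻¹ = a i * b i * (a i)⁻¹ * (b i)⁻¹) :
    ((List.range g).map (relFactor (localGens A B))).prod = 1 := by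
  have : relFactor (localGens A B) =
      relFactor (fun p => (PresentedGroup.of p : SurfaceGroup g)) := by
    funext i
    unfold relFactor
    split_ifs with h
    · simpa [a_def, b_def] using hAB ⟨i, h⟩
    · rfl
  rw [this]
  exact prod_relFactor_of

/-! ### Two-handle generator images -/

/-- The middle block `mid k l = ∏_{k<h<l} [a_h, b_h]` of the relator. [folklore] -/
def mid (k l : ℕ) : SurfaceGroup g :=
  ((List.range' (k + 1) (l - k - 1)).map
    (relFactor fun p => (PresentedGroup.of p : SurfaceGroup g))).prod

/-- A homomorphism fixing the generators of the handles strictly between `k` and `l` fixes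
`mid k l`. [folklore] -/
theorem map_mid (φ : SurfaceGroup g →* SurfaceGroup g) {k l : ℕ}
    (hφ : ∀ i : Fin g, k < i → (i : ℕ) < l → ∀ s, φ (PresentedGroup.of (i, s)) =
      PresentedGroup.of (i, s)) :
    φ (mid k l) = mid k l := by
  unfold mid
  rw [map_list_prod, List.map_map]
  congr 1
  refine List.map_congr_left fun i hi => ?_
  rw [List.mem_range'_1] at hi
  rw [Function.comp_apply, map_relFactor]
  unfold relFactor
  split_ifs with hig
  · simp [hφ ⟨i, hig⟩ (show k < i by omega) (show i < l by omega)]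
  · rfl

/-- A homomorphism killing one of `aⱼ, bⱼ` for every `j` kills `mid k l`. [folklore] -/
theorem map_mid_eq_one {M : Type*} [Group M] (φ : SurfaceGroup g →* M) (k l : ℕ)
    (hφ : ∀ j : Fin g, φ (a j) = 1 ∨ φ (b j) = 1) : φ (mid k l) = 1 := by
  unfold mid
  rw [map_list_prod, List.map_map]
  exact List.prod_eq_one fun x hx => by
    obtain ⟨i, -, rfl⟩ := List.mem_map.1 hx
    rw [Function.comp_apply, map_relFactor]
    exact relFactor_eq_one_of_hits _ i hφ

/-- Generator images of a two-handle map: `a_k, b_k, a_l, b_l ↦ Ak, Bk, Al, Bl`, all other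
generators fixed. [folklore] -/
def blockGens (k l : Fin g) (Ak Bk Al Bl : SurfaceGroup g) (p : surfaceGen g) : SurfaceGroup g :=
  if p.1 = k then bif p.2 then Bk else Ak
  else if p.1 = l then bif p.2 then Bl else Al
  else PresentedGroup.of p

section block

variable {k l : Fin g} (hkl : k < l) (Ak Bk Al Bl : SurfaceGroup g)

/-- `blockGens` on `a_k`. [folklore] -/
@[simp] theorem blockGens_k_false : blockGens k l Ak Bk Al Bl (k, false) = Ak := by
  simp [blockGens]

/-- `blockGens` on `b_k`. [folklore] -/
@[simp] theorem blockGens_k_true : blockGens k l Ak Bk Al Bl (k, true) = Bk := by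
  simp [blockGens]

include hkl in
/-- `blockGens` on `a_l`. [folklore] -/
@[simp] theorem blockGens_l_false : blockGens k l Ak Bk Al Bl (l, false) = Al := by
  simp [blockGens, hkl.ne']

include hkl in
/-- `blockGens` on `b_l`. [folklore] -/
@[simp] theorem blockGens_l_true : blockGens k l Ak Bk Al Bl (l, true) = Bl := by
  simp [blockGens, hkl.ne']

/-- `blockGens` off the two handles. [folklore] -/
theorem blockGens_of_ne {i : Fin g} (hik : i ≠ k) (hil : i ≠ l) (s : Bool) :
    blockGens k l Ak Bk Al Bl (i, s) = PresentedGroup.of (i, s) := by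
  simp [blockGens, hik, hil]

include hkl in
/-- Two-handle images fixing the block `[a_k,b_k] · mid k l · [a_l,b_l]` kill the relator.
[folklore] -/
theorem prod_relFactor_blockGens
    (h : Ak * Bk * Ak⁻¹ * Bk⁻¹ * (mid k l * (Al * Bl * Al⁻¹ * Bl⁻¹)) =
      a k * b k * (a k)⁻¹ * (b k)⁻¹ * (mid k l * (a l * b l * (a l)⁻¹ * (b l)⁻¹))) :
    ((List.range g).map (relFactor (blockGens k l Ak Bk Al Bl))).prod = 1 := by
  refine (prod_map_range_eq_of_block (F' := relFactor (blockGens k l Ak Bk Al Bl))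
    (F := relFactor fun p => (PresentedGroup.of p : SurfaceGroup g)) hkl l.2 ?_ ?_).trans
    prod_relFactor_of
  · intro i hik hil
    unfold relFactor
    split_ifs with hi
    · have hik' : (⟨i, hi⟩ : Fin g) ≠ k := fun e => hik (congrArg Fin.val e)
      have hil' : (⟨i, hi⟩ : Fin g) ≠ l := fun e => hil (congrArg Fin.val e)
      simp [blockGens_of_ne _ _ _ _ hik' hil']
    · rfl
  · simpa [relFactor_fin, hkl, mid, a_def, b_def] using h

/-- The endomorphism with two-handle generator images fixes `mid k l`. [folklore] -/
@[simp] theorem homOfGens_blockGens_mid (h) :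
    homOfGens (blockGens k l Ak Bk Al Bl) h (mid k l) = mid k l :=
  map_mid _ fun i hki hil s => by
    rw [homOfGens_of, blockGens_of_ne]
    · exact fun e => by subst e; omega
    · exact fun e => by subst e; omega

end block

end SurfaceGroup

end Literature.Topology.FourManifolds

end
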